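import Mathlib
import HarnessLib
import Summits.HubbardSuperconductivity.HubbardSuperconductivity.Theorems.KLProgrammeKLRegimeTwoVolumeStepLinear

/-!
# Route `KLProgramme` — crux K3, VL child `KLRegimeVolumeLimitV17F2` (stmt-HubbardSuperconductivity-20440), blueprint v5 M5: THE FINE-SIDE FRAME COMPOSITE (M3f)
# IS ε-HOMOGENEOUS AND LINEAR IN ITS FRAME SOURCES (seat hubbard-kl-k3c4-p1 g12; `--supports` 20440)

`…TwoVolumeFrameComposite.sum_norm_kernel_frameComposite_le` (p590168) bounds the fine volume's own-frame step against its frame-`K` twin by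
`RESP + LIP`, a formal expression in: the entry sup `sE` and the rows/columns `cR, cC` of the covariance defect `E = C[K″] − C[K]`, the rows `αC` of `C`, the
substitution defect `δ` (rows/columns of `T″ − T`) through `NB(m′) = 2m′·a^{2m′−1}·δ·NX(2m′)`, and the field-weighted norms of the profiles `NW, NB`.  For the
limit spine (`…DefectSupSpine`) this file provides, exactly as `…StepEpsHomog` / `…StepLinear` do for the two-volume step:

* `frameComposite_rhs_eps_homog` — under the normalisation of record (`αC, cR, cC ↦ ·/ε`, profiles `↦ ε×·`, `sE, δ, a` ε-free) the expression is `ε ×` itself;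
* **`frameComposite_rhs_le_linear`** — with volume-free majorants of the norms and barred smallness numbers it is at most
  `sE·K₁ + (cR + cC)·K₂ + δ·K₃` with volume-free `K`'s (the frame sources `sE, cR, cC, δ → 0` with the volume, k3c4-p2's (w7) and p587829).

Pure real algebra; no definition.
-/

noncomputable section

namespace Summit.HubbardSuperconductivity.HubbardSuperconductivity.Theorems.TwoVolumeDefect

set_option linter.dupNamespace false -- summit = problem name (single-conjunct summit), D-0017

open Finset Literature.MathematicalPhysics.QuantumLattice

/-- **ε-HOMOGENEITY OF THE FRAME COMPOSITE.** [folklore: bookkeeping of `…TwoVolumeFrameComposite`] -/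
theorem frameComposite_rhs_eps_homog (Γ' : Type) [Fintype Γ'] (n : ℕ) {ε : ℝ} (hε : ε ≠ 0) (sE cR cC αC κ ρ a δ : ℝ) (NW NX : ℕ → ℝ)
    (NB NBε : ℕ → ℝ) (hNB : ∀ m', NB m' = (2 * m' : ℕ) * a ^ (2 * m' - 1) * δ * NX (2 * m'))
    (hNBε : ∀ m', NBε m' = (2 * m' : ℕ) * a ^ (2 * m' - 1) * δ * (ε * NX (2 * m'))) :
    ((((n + 1 + 1) * (n + 1 + 2) : ℕ) : ℝ) / 2 * sE *
          (ρ⁻¹ ^ (n + 3) * (Real.exp 1 * normV Γ' κ ρ (fun m' => ε * NW m' + NBε m')) /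
            (1 - Real.exp 1 * (αC / ε + (cR / ε + cC / ε)) * normV Γ' κ ρ (fun m' => ε * NW m' + NBε m') / κ ^ 2)) +
        ‖(2 : ℂ)⁻¹‖ * ∑ a' ∈ range (n + 2), ∑ b' ∈ range (n + 2),
          (if a' + b' = n + 1 then (((a' + 1) * (b' + 1) : ℕ) : ℝ) *
            (cR / ε * (ρ⁻¹ ^ (a' + 1) * (Real.exp 1 * normV Γ' κ ρ (fun m' => ε * NW m' + NBε m')) /
                  (1 - Real.exp 1 * (αC / ε + (cR / ε + cC / ε)) * normV Γ' κ ρ (fun m' => ε * NW m' + NBε m') / κ ^ 2)) *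
                (ρ⁻¹ ^ (b' + 1) * (Real.exp 1 * normV Γ' κ ρ (fun m' => ε * NW m' + NBε m')) /
                  (1 - Real.exp 1 * (αC / ε + (cR / ε + cC / ε)) * normV Γ' κ ρ (fun m' => ε * NW m' + NBε m') / κ ^ 2)) +
              cC / ε * (ρ⁻¹ ^ (a' + 1) * (Real.exp 1 * normV Γ' κ ρ (fun m' => ε * NW m' + NBε m')) /
                  (1 - Real.exp 1 * (αC / ε + (cR / ε + cC / ε)) * normV Γ' κ ρ (fun m' => ε * NW m' + NBε m') / κ ^ 2)) *
                (ρ⁻¹ ^ (b' + 1) * (Real.exp 1 * normV Γ' κ ρ (fun m' => ε * NW m' + NBε m')) /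
                  (1 - Real.exp 1 * (αC / ε + (cR / ε + cC / ε)) * normV Γ' κ ρ (fun m' => ε * NW m' + NBε m') / κ ^ 2))) else 0)) +
      ρ⁻¹ ^ (n + 1) * (Real.exp 1 * normV Γ' κ ρ NBε) / (1 - Real.exp 1 * (αC / ε) * (normV Γ' κ ρ (fun m' => ε * NW m') + normV Γ' κ ρ NBε) / κ ^ 2) ^ 2 =
    ε * (((((n + 1 + 1) * (n + 1 + 2) : ℕ) : ℝ) / 2 * sE *
          (ρ⁻¹ ^ (n + 3) * (Real.exp 1 * normV Γ' κ ρ (fun m' => NW m' + NB m')) /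
            (1 - Real.exp 1 * (αC + (cR + cC)) * normV Γ' κ ρ (fun m' => NW m' + NB m') / κ ^ 2)) +
        ‖(2 : ℂ)⁻¹‖ * ∑ a' ∈ range (n + 2), ∑ b' ∈ range (n + 2),
          (if a' + b' = n + 1 then (((a' + 1) * (b' + 1) : ℕ) : ℝ) *
            (cR * (ρ⁻¹ ^ (a' + 1) * (Real.exp 1 * normV Γ' κ ρ (fun m' => NW m' + NB m')) /
                  (1 - Real.exp 1 * (αC + (cR + cC)) * normV Γ' κ ρ (fun m' => NW m' + NB m') / κ ^ 2)) *
                (ρ⁻¹ ^ (b' + 1) * (Real.exp 1 * normV Γ' κ ρ (fun m' => NW m' + NB m')) /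
                  (1 - Real.exp 1 * (αC + (cR + cC)) * normV Γ' κ ρ (fun m' => NW m' + NB m') / κ ^ 2)) +
              cC * (ρ⁻¹ ^ (a' + 1) * (Real.exp 1 * normV Γ' κ ρ (fun m' => NW m' + NB m')) /
                  (1 - Real.exp 1 * (αC + (cR + cC)) * normV Γ' κ ρ (fun m' => NW m' + NB m') / κ ^ 2)) *
                (ρ⁻¹ ^ (b' + 1) * (Real.exp 1 * normV Γ' κ ρ (fun m' => NW m' + NB m')) /
                  (1 - Real.exp 1 * (αC + (cR + cC)) * normV Γ' κ ρ (fun m' => NW m' + NB m') / κ ^ 2))) else 0)) +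
      ρ⁻¹ ^ (n + 1) * (Real.exp 1 * normV Γ' κ ρ NB) / (1 - Real.exp 1 * αC * (normV Γ' κ ρ NW + normV Γ' κ ρ NB) / κ ^ 2) ^ 2) := by
  -- `NBε = ε·NB`, and every `normV` is linear in the profile
  have hBB : NBε = fun m' => ε * NB m' := by funext m'; rw [hNBε, hNB]; ring
  have h1 : normV Γ' κ ρ (fun m' => ε * NW m' + NBε m') = ε * normV Γ' κ ρ (fun m' => NW m' + NB m') := by
    rw [hBB, ← normV_const_mul]; congr 1; funext m; ring
  have h2 : normV Γ' κ ρ NBε = ε * normV Γ' κ ρ NB := by rw [hBB, normV_const_mul]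
  have h3 : normV Γ' κ ρ (fun m' => ε * NW m') = ε * normV Γ' κ ρ NW := normV_const_mul κ ρ ε NW
  rw [h1, h2, h3]
  -- the smallness numbers are ε-invariant
  have hθ₁ : Real.exp 1 * (αC / ε + (cR / ε + cC / ε)) * (ε * normV Γ' κ ρ (fun m' => NW m' + NB m')) =
      Real.exp 1 * (αC + (cR + cC)) * normV Γ' κ ρ (fun m' => NW m' + NB m') := by field_simp
  have hθ₂ : Real.exp 1 * (αC / ε) * (ε * normV Γ' κ ρ NW + ε * normV Γ' κ ρ NB) = Real.exp 1 * αC * (normV Γ' κ ρ NW + normV Γ' κ ρ NB) := by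
    field_simp
  rw [hθ₁, hθ₂]
  -- the brackets are `ε ×` the unscaled ones
  have hB : ∀ (θ : ℝ) (k : ℕ), ρ⁻¹ ^ k * (Real.exp 1 * (ε * normV Γ' κ ρ (fun m' => NW m' + NB m'))) / (1 - θ) =
      ε * (ρ⁻¹ ^ k * (Real.exp 1 * normV Γ' κ ρ (fun m' => NW m' + NB m')) / (1 - θ)) := fun θ k => by ring
  simp only [hB]
  have hif : ∀ (a' b' : ℕ) (x y : ℝ), (if a' + b' = n + 1 then (((a' + 1) * (b' + 1) : ℕ) : ℝ) * (cR / ε * (ε * x) * (ε * y) + cC / ε * (ε * x) * (ε * y)) else 0) =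
      ε * (if a' + b' = n + 1 then (((a' + 1) * (b' + 1) : ℕ) : ℝ) * (cR * x * y + cC * x * y) else 0) := by
    intro a' b' x y; split_ifs
    · field_simp
    · ring
  simp only [hif, ← Finset.mul_sum]
  field_simp

/-- **THE FRAME COMPOSITE IN LINEAR FORM WITH VOLUME-FREE COEFFICIENTS**: with volume-free majorants `ν₆ ≥ normV(NW + N̄B)` (`N̄B` = `NB` at the barred defect
`δ̄ ≥ δ`), `ν₇ ≥ normV NW`, `ν₈ ≥ normV (m′ ↦ 2m′·a^{2m′−1}·NX(2m′))`, barred constants `c̄R ≥ cR`, `c̄C ≥ cC`, and the barred smallness numbers `< 1`, the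
right-hand side of `sum_norm_kernel_frameComposite_le` is at most `sE·K₁ + (cR + cC)·K₂ + δ·K₃`. [folklore: monotonicity of the Gawȩdzki–Kupiainen brackets] -/
theorem frameComposite_rhs_le_linear (Γ' : Type) [Fintype Γ'] (n : ℕ) {sE cR cC cRb cCb αC κ ρ a δ δb ν₆ ν₇ ν₈ : ℝ} {NW NX : ℕ → ℝ} (NB : ℕ → ℝ)
    (hNB : ∀ m', NB m' = (2 * m' : ℕ) * a ^ (2 * m' - 1) * δ * NX (2 * m'))
    (hκ : 0 ≤ κ) (hρ : 0 < ρ) (hsE : 0 ≤ sE) (hcR : 0 ≤ cR) (hcC : 0 ≤ cC) (hcRb : cR ≤ cRb) (hcCb : cC ≤ cCb) (hαC : 0 ≤ αC) (ha : 0 ≤ a)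
    (hδ : 0 ≤ δ) (hδb : δ ≤ δb) (hNW : ∀ m', 0 ≤ NW m') (hNX : ∀ k, 0 ≤ NX k)
    (hν₆ : normV Γ' κ ρ (fun m' => NW m' + (2 * m' : ℕ) * a ^ (2 * m' - 1) * δb * NX (2 * m')) ≤ ν₆) (hν₇ : normV Γ' κ ρ NW ≤ ν₇)
    (hν₈ : normV Γ' κ ρ (fun m' => (2 * m' : ℕ) * a ^ (2 * m' - 1) * NX (2 * m')) ≤ ν₈)
    (hθ₁ : Real.exp 1 * (αC + (cRb + cCb)) * ν₆ / κ ^ 2 < 1) (hθ₂ : Real.exp 1 * αC * (ν₇ + δb * ν₈) / κ ^ 2 < 1) :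
    ((((n + 1 + 1) * (n + 1 + 2) : ℕ) : ℝ) / 2 * sE *
          (ρ⁻¹ ^ (n + 3) * (Real.exp 1 * normV Γ' κ ρ (fun m' => NW m' + NB m')) /
            (1 - Real.exp 1 * (αC + (cR + cC)) * normV Γ' κ ρ (fun m' => NW m' + NB m') / κ ^ 2)) +
        ‖(2 : ℂ)⁻¹‖ * ∑ a' ∈ range (n + 2), ∑ b' ∈ range (n + 2),
          (if a' + b' = n + 1 then (((a' + 1) * (b' + 1) : ℕ) : ℝ) *
            (cR * (ρ⁻¹ ^ (a' + 1) * (Real.exp 1 * normV Γ' κ ρ (fun m' => NW m' + NB m')) /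
                  (1 - Real.exp 1 * (αC + (cR + cC)) * normV Γ' κ ρ (fun m' => NW m' + NB m') / κ ^ 2)) *
                (ρ⁻¹ ^ (b' + 1) * (Real.exp 1 * normV Γ' κ ρ (fun m' => NW m' + NB m')) /
                  (1 - Real.exp 1 * (αC + (cR + cC)) * normV Γ' κ ρ (fun m' => NW m' + NB m') / κ ^ 2)) +
              cC * (ρ⁻¹ ^ (a' + 1) * (Real.exp 1 * normV Γ' κ ρ (fun m' => NW m' + NB m')) /
                  (1 - Real.exp 1 * (αC + (cR + cC)) * normV Γ' κ ρ (fun m' => NW m' + NB m') / κ ^ 2)) *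
                (ρ⁻¹ ^ (b' + 1) * (Real.exp 1 * normV Γ' κ ρ (fun m' => NW m' + NB m')) /
                  (1 - Real.exp 1 * (αC + (cR + cC)) * normV Γ' κ ρ (fun m' => NW m' + NB m') / κ ^ 2))) else 0)) +
      ρ⁻¹ ^ (n + 1) * (Real.exp 1 * normV Γ' κ ρ NB) / (1 - Real.exp 1 * αC * (normV Γ' κ ρ NW + normV Γ' κ ρ NB) / κ ^ 2) ^ 2 ≤
    sE * ((((n + 1 + 1) * (n + 1 + 2) : ℕ) : ℝ) / 2 * (ρ⁻¹ ^ (n + 3) * (Real.exp 1 * ν₆) / (1 - Real.exp 1 * (αC + (cRb + cCb)) * ν₆ / κ ^ 2))) +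
      (cR + cC) * (‖(2 : ℂ)⁻¹‖ * ∑ a' ∈ range (n + 2), ∑ b' ∈ range (n + 2),
          (if a' + b' = n + 1 then (((a' + 1) * (b' + 1) : ℕ) : ℝ) *
            ((ρ⁻¹ ^ (a' + 1) * (Real.exp 1 * ν₆) / (1 - Real.exp 1 * (αC + (cRb + cCb)) * ν₆ / κ ^ 2)) *
              (ρ⁻¹ ^ (b' + 1) * (Real.exp 1 * ν₆) / (1 - Real.exp 1 * (αC + (cRb + cCb)) * ν₆ / κ ^ 2))) else 0)) +
      δ * (ρ⁻¹ ^ (n + 1) * (Real.exp 1 * ν₈) / (1 - Real.exp 1 * αC * (ν₇ + δb * ν₈) / κ ^ 2) ^ 2) := by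
  set e : ℝ := Real.exp 1 with he
  set X : ℝ := normV Γ' κ ρ (fun m' => NW m' + NB m') with hX
  set X₇ : ℝ := normV Γ' κ ρ NW with hX₇
  set XB : ℝ := normV Γ' κ ρ NB with hXB
  have he0 : 0 ≤ e := (Real.exp_pos 1).le
  -- `NB = δ·(…)`, so `normV NB = δ·normV(…) ≤ δ·ν₈ ≤ δ̄·ν₈`, and `NB ≤ N̄B`
  have hNB0 : ∀ m', 0 ≤ NB m' := fun m' => by
    rw [hNB]; exact mul_nonneg (mul_nonneg (mul_nonneg (by positivity) (pow_nonneg ha _)) hδ) (hNX _)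
  have hXBeq : XB = δ * normV Γ' κ ρ (fun m' => (2 * m' : ℕ) * a ^ (2 * m' - 1) * NX (2 * m')) := by
    rw [hXB, ← normV_const_mul]; congr 1; funext m'; rw [hNB]; ring
  have hν₈0 : 0 ≤ ν₈ := (normV_nonneg hκ hρ.le fun m' => mul_nonneg (mul_nonneg (by positivity) (pow_nonneg ha _)) (hNX _)).trans hν₈
  have hcRb0 : 0 ≤ cRb := hcR.trans hcRb
  have hcCb0 : 0 ≤ cCb := hcC.trans hcCb
  have hδb0 : 0 ≤ δb := hδ.trans hδb
  have hXBle : XB ≤ δ * ν₈ := by rw [hXBeq]; exact mul_le_mul_of_nonneg_left hν₈ hδ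
  have hXBleb : XB ≤ δb * ν₈ := hXBle.trans (mul_le_mul_of_nonneg_right hδb hν₈0)
  have hXB0 : 0 ≤ XB := normV_nonneg hκ hρ.le hNB0
  have hX0 : 0 ≤ X := normV_nonneg hκ hρ.le fun m' => add_nonneg (hNW m') (hNB0 m')
  have hX₇0 : 0 ≤ X₇ := normV_nonneg hκ hρ.le hNW
  have hXle : X ≤ ν₆ := by
    refine le_trans (normV_mono hκ hρ.le fun m' => ?_) hν₆
    rw [hNB]; gcongr; exact hNX _
  have hν₆0 : 0 ≤ ν₆ := hX0.trans hXle
  -- the smallness numbers are monotone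
  have hθ₁le : e * (αC + (cR + cC)) * X / κ ^ 2 ≤ e * (αC + (cRb + cCb)) * ν₆ / κ ^ 2 := by gcongr
  have hθ₂le : e * αC * (X₇ + XB) / κ ^ 2 ≤ e * αC * (ν₇ + δb * ν₈) / κ ^ 2 := by gcongr
  -- the bracket `G_k`
  have hG : ∀ k : ℕ, 0 ≤ ρ⁻¹ ^ k * (e * X) / (1 - e * (αC + (cR + cC)) * X / κ ^ 2) ∧
      ρ⁻¹ ^ k * (e * X) / (1 - e * (αC + (cR + cC)) * X / κ ^ 2) ≤ ρ⁻¹ ^ k * (e * ν₆) / (1 - e * (αC + (cRb + cCb)) * ν₆ / κ ^ 2) := by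
    intro k
    refine ⟨div_nonneg (by positivity) (by linarith), div_one_sub_mono (by positivity) ?_ hθ₁le hθ₁⟩
    gcongr
  have hGb0 : ∀ k : ℕ, 0 ≤ ρ⁻¹ ^ k * (e * ν₆) / (1 - e * (αC + (cRb + cCb)) * ν₆ / κ ^ 2) := fun k => (hG k).1.trans (hG k).2
  -- term 1
  have h1 : (((n + 1 + 1) * (n + 1 + 2) : ℕ) : ℝ) / 2 * sE * (ρ⁻¹ ^ (n + 3) * (e * X) / (1 - e * (αC + (cR + cC)) * X / κ ^ 2)) ≤
      sE * ((((n + 1 + 1) * (n + 1 + 2) : ℕ) : ℝ) / 2 * (ρ⁻¹ ^ (n + 3) * (e * ν₆) / (1 - e * (αC + (cRb + cCb)) * ν₆ / κ ^ 2))) := by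
    calc (((n + 1 + 1) * (n + 1 + 2) : ℕ) : ℝ) / 2 * sE * (ρ⁻¹ ^ (n + 3) * (e * X) / (1 - e * (αC + (cR + cC)) * X / κ ^ 2))
        ≤ (((n + 1 + 1) * (n + 1 + 2) : ℕ) : ℝ) / 2 * sE * (ρ⁻¹ ^ (n + 3) * (e * ν₆) / (1 - e * (αC + (cRb + cCb)) * ν₆ / κ ^ 2)) :=
          mul_le_mul_of_nonneg_left (hG _).2 (by positivity)
      _ = _ := by ring
  -- term 2
  have h2 : ‖(2 : ℂ)⁻¹‖ * ∑ a' ∈ range (n + 2), ∑ b' ∈ range (n + 2),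
        (if a' + b' = n + 1 then (((a' + 1) * (b' + 1) : ℕ) : ℝ) *
          (cR * (ρ⁻¹ ^ (a' + 1) * (e * X) / (1 - e * (αC + (cR + cC)) * X / κ ^ 2)) * (ρ⁻¹ ^ (b' + 1) * (e * X) / (1 - e * (αC + (cR + cC)) * X / κ ^ 2)) +
            cC * (ρ⁻¹ ^ (a' + 1) * (e * X) / (1 - e * (αC + (cR + cC)) * X / κ ^ 2)) * (ρ⁻¹ ^ (b' + 1) * (e * X) / (1 - e * (αC + (cR + cC)) * X / κ ^ 2)))
          else 0) ≤
      (cR + cC) * (‖(2 : ℂ)⁻¹‖ * ∑ a' ∈ range (n + 2), ∑ b' ∈ range (n + 2),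
        (if a' + b' = n + 1 then (((a' + 1) * (b' + 1) : ℕ) : ℝ) *
          ((ρ⁻¹ ^ (a' + 1) * (e * ν₆) / (1 - e * (αC + (cRb + cCb)) * ν₆ / κ ^ 2)) * (ρ⁻¹ ^ (b' + 1) * (e * ν₆) / (1 - e * (αC + (cRb + cCb)) * ν₆ / κ ^ 2)))
          else 0)) := by
    have hif : ∀ (a' b' : ℕ) (x y : ℝ), (cR + cC) * (if a' + b' = n + 1 then (((a' + 1) * (b' + 1) : ℕ) : ℝ) * (x * y) else 0) =
        (if a' + b' = n + 1 then (((a' + 1) * (b' + 1) : ℕ) : ℝ) * ((cR + cC) * x * y) else 0) := by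
      intro a' b' x y; split_ifs <;> ring
    have hR : (cR + cC) * (‖(2 : ℂ)⁻¹‖ * ∑ a' ∈ range (n + 2), ∑ b' ∈ range (n + 2),
        (if a' + b' = n + 1 then (((a' + 1) * (b' + 1) : ℕ) : ℝ) *
          ((ρ⁻¹ ^ (a' + 1) * (e * ν₆) / (1 - e * (αC + (cRb + cCb)) * ν₆ / κ ^ 2)) * (ρ⁻¹ ^ (b' + 1) * (e * ν₆) / (1 - e * (αC + (cRb + cCb)) * ν₆ / κ ^ 2)))
          else 0)) =
        ‖(2 : ℂ)⁻¹‖ * ∑ a' ∈ range (n + 2), ∑ b' ∈ range (n + 2),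
          (if a' + b' = n + 1 then (((a' + 1) * (b' + 1) : ℕ) : ℝ) *
            ((cR + cC) * (ρ⁻¹ ^ (a' + 1) * (e * ν₆) / (1 - e * (αC + (cRb + cCb)) * ν₆ / κ ^ 2)) *
              (ρ⁻¹ ^ (b' + 1) * (e * ν₆) / (1 - e * (αC + (cRb + cCb)) * ν₆ / κ ^ 2))) else 0) := by
      rw [mul_left_comm, Finset.mul_sum]
      refine congrArg _ (sum_congr rfl fun a' _ => ?_)
      rw [Finset.mul_sum]
      exact sum_congr rfl fun b' _ => hif a' b' _ _
    rw [hR]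
    refine mul_le_mul_of_nonneg_left (sum_le_sum fun a' _ => sum_le_sum fun b' _ => ?_) (norm_nonneg _)
    split_ifs
    · refine mul_le_mul_of_nonneg_left ?_ (by positivity)
      have hxy := mul_le_mul (hG (a' + 1)).2 (hG (b' + 1)).2 (hG _).1 (hGb0 _)
      have hsum : cR * ((ρ⁻¹ ^ (a' + 1) * (e * X) / (1 - e * (αC + (cR + cC)) * X / κ ^ 2)) * (ρ⁻¹ ^ (b' + 1) * (e * X) / (1 - e * (αC + (cR + cC)) * X / κ ^ 2))) +
          cC * ((ρ⁻¹ ^ (a' + 1) * (e * X) / (1 - e * (αC + (cR + cC)) * X / κ ^ 2)) * (ρ⁻¹ ^ (b' + 1) * (e * X) / (1 - e * (αC + (cR + cC)) * X / κ ^ 2))) ≤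
          cR * ((ρ⁻¹ ^ (a' + 1) * (e * ν₆) / (1 - e * (αC + (cRb + cCb)) * ν₆ / κ ^ 2)) * (ρ⁻¹ ^ (b' + 1) * (e * ν₆) / (1 - e * (αC + (cRb + cCb)) * ν₆ / κ ^ 2))) +
          cC * ((ρ⁻¹ ^ (a' + 1) * (e * ν₆) / (1 - e * (αC + (cRb + cCb)) * ν₆ / κ ^ 2)) * (ρ⁻¹ ^ (b' + 1) * (e * ν₆) / (1 - e * (αC + (cRb + cCb)) * ν₆ / κ ^ 2))) :=
        add_le_add (mul_le_mul_of_nonneg_left hxy hcR) (mul_le_mul_of_nonneg_left hxy hcC)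
      refine le_trans (le_of_eq (by ring)) (hsum.trans (le_of_eq (by ring)))
    · exact le_rfl
  -- term 3
  have h3 : ρ⁻¹ ^ (n + 1) * (e * XB) / (1 - e * αC * (X₇ + XB) / κ ^ 2) ^ 2 ≤ δ * (ρ⁻¹ ^ (n + 1) * (e * ν₈) / (1 - e * αC * (ν₇ + δb * ν₈) / κ ^ 2) ^ 2) := by
    calc ρ⁻¹ ^ (n + 1) * (e * XB) / (1 - e * αC * (X₇ + XB) / κ ^ 2) ^ 2
        ≤ ρ⁻¹ ^ (n + 1) * (e * (δ * ν₈)) / (1 - e * αC * (X₇ + XB) / κ ^ 2) ^ 2 := by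
          refine div_le_div_of_nonneg_right ?_ (sq_nonneg _); gcongr
      _ ≤ ρ⁻¹ ^ (n + 1) * (e * (δ * ν₈)) / (1 - e * αC * (ν₇ + δb * ν₈) / κ ^ 2) ^ 2 := div_one_sub_sq_mono (by positivity) hθ₂le hθ₂
      _ = _ := by ring
  exact add_le_add (add_le_add h1 h2) h3

end Summit.HubbardSuperconductivity.HubbardSuperconductivity.Theorems.TwoVolumeDefect

end
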